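import Mathlib.Computability.Language
import Mathlib.Analysis.SpecialFunctions.Pow.Real
import Literature.Computability.Complexity.TimeBounds
import Literature.Computability.Complexity.BoolEncodings
import Literature.Computability.Complexity.Oracle
import HarnessLib

-- provenance: harness21/H21/H21/Prelude/CryptoQuantFine/Subexponential.lean @ f7e0a8e (interim HEAD d8f2665); M5 mechanical rewrite
/-!
# Crypto/Quantum/Fine-grained prelude: subexponential time (SE) and SERF reductions

Trunk `CryptoQuantFine`, outline item F7 (realises the SE/SERF part of the notions
`ksat_time_exponent` and `fine_grained_reduction`). Following Impagliazzo–Paturi–Zane, a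
*parameterised problem* is a language `L ⊆ {0,1}*` together with a complexity parameter
`p : {0,1}* → ℕ` (number of variables, of vertices, …). The class `SE` consists of those
parameterised problems solvable in time `poly(|x|) · 2^{ε p(x)}` for *every* `ε > 0`, and
`SERFReducible Q₁ Q₂` (a *SubExponential Reduction Family*) is a family, indexed by `ε > 0`, of
oracle (Turing) reductions from `Q₁` to `Q₂` running in time `poly(|x|) · 2^{ε p₁(x)}` whose
queries `q` have parameter `p₂(q) = O(p₁(x))` and length `poly(|x|)`. SE is closed downwards
under SERF reductions (IPZ §2).

Contents: `ParamProblem`, `ParamProblem.ofEncoding`, `IsSubexpTimeBound`, `SE`,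
`SERFReducible`, and the API `mem_SE_of_param_le` (the outline's `SE_param_mono` /
`SE.of_param_le`), `SERFReducible.refl`, `SERFReducible.trans`, `mem_SE_of_serfReducible`,
`mem_SE_iff_forall_delta`.

Mathlib has no subexponential-time class, no parameterised problem and no SERF/fine-grained
reduction (searched `Subexp`, `SERF`, `Parameterized`, `ETH`); we reuse `Language`,
`Computability.Encoding`, `Set.boolIndicator`, `Real.rpow`, Mathlib's bundled TM2 machines
`Turing.TM2ComputableAux`, and the accepted H21 `CplxCore` notions `DecidesInTime`,
`ComputesInTime`, `OracleAlg` (`run`, `queries`), `Oracle.ofLanguage`, `boolPair`,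
`Encoding.listBool`, `Encoding.sumBool`.

## Design notes

* Machine model (outline D1(i)): everything here has polynomial slack in `|x|` and slack
  `2^{O(ε) p}` in the parameter, so multitape TM2 (`ComputesInTime`/`DecidesInTime` with the
  identity encoder `id : List Bool → List Bool`) is adequate.
* `IsSubexpTimeBound ε p T` is the per-input bound `T x ≤ c · 2^{ε p(x)} · (|x|+1)^c` with a
  real exponent (`Real.rpow`); the single constant `c` doubles as coefficient and degree
  (closure proofs may take `c ≥ 1` w.l.o.g.). Cf. `IsExpPolyBound` of
  `H21/Statements/FineGrained/Wave0.lean` (not imported here, on purpose).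
* IPZ require the complexity parameter to be polynomial-time computable and polynomially
  bounded in `|x|`; `ParamProblem` does **not** enforce this (the one IPZ hypothesis dropped).
  Statement authors needing it (e.g. to compute the clock `2^{ε p(x)}` inside
  `SERFReducible.trans` / `mem_SE_of_serfReducible`) must add it as an explicit hypothesis;
  for the intended instances (`k`-SAT with `p =` number of variables or clauses) it holds.
* SERF through transcript oracles (outline R2). An `OracleAlg` is a step function
  (input, answers so far) ↦ query/output, re-run from scratch at every round. The step-time
  clause of `SERFReducible` bounds each step by `c · 2^{ε p₁(x)} · (|x|+1)^c · (ℓ + 1)` where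
  `ℓ` is the length of the `listBool`-encoded answer transcript — polynomial of an
  ε-dependent degree in `|x|` but only *linear* (ε-independent degree) in the transcript;
  an ε-dependent degree on the transcript would let a reduction buy time `2^{c(ε) ε p₁}` by
  asking `2^{ε p₁}` dummy queries and would make `mem_SE_of_serfReducible` false. With
  `fuel x ≤ 2^{ε p₁ x}·poly` rounds, transcripts of length `≤ 2^{ε p₁ x}·poly`, the total TM
  time is `2^{3ε p₁(x)}·poly(|x|)` rather than IPZ's `2^{ε p₁(x)}·poly(|x|)`. Since both `SE`
  and `SERFReducible` quantify over *all* `ε > 0`, this ε-independent constant-factor loss in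
  the exponent is invisible: the resulting notions coincide with IPZ's (a genuine IPZ
  reduction realises the linear-in-transcript step bound by clocked re-simulation).
* IPZ (§2.1) also allow *randomised* SERF reductions (bounded-error Turing reductions); v0
  defines the deterministic notion only (outline D3/R2). All uses in H21 (sparsification,
  `SNP ⊆ SE`-hardness of k-SAT) are deterministic in print.
* `ParamProblem.ofEncoding` assigns parameter `0` to non-codewords (strings `x` that are not
  `e.encode a` for the unique `a` with `e.decode x = some a`); non-codewords are never in
  `e.toLanguage S`, and parameter `0` only makes the time bound *stricter* (`poly(|x|)`),
  which is the intended reading (reject syntactically invalid inputs in polynomial time).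
* No `IsRefl`/`IsTrans` instances are registered for `SERFReducible` (proofs are `sorry`d
  known results needing machine composition, cf. `PolyTimeComputable.comp`).

## References

* R. Impagliazzo, R. Paturi, F. Zane, *Which problems have strongly exponential complexity?*,
  J. Comput. System Sci. 63 (2001) 512–530, §2 (SE, SERF, closure of SE under SERF).
* R. Impagliazzo, R. Paturi, *On the complexity of k-SAT*, J. Comput. System Sci. 62 (2001),
  §1 (s_k, ETH).
* H21 outline `CryptoQuantFine`, F7, D1, D3, R2.
-/

namespace Literature.Computability.Cryptography

open _root_.Computability Turing Complexity

/-! ### Parameterised problems and subexponential time bounds -/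

/-- A *parameterised problem* in the sense of Impagliazzo–Paturi–Zane: a language
`lang ⊆ {0,1}*` together with a (polynomial-time computable, polynomially bounded — not
enforced here) complexity parameter `param : {0,1}* → ℕ`, e.g. the number of variables of a
CNF or of vertices of a graph. [IPZ 2001, §2, "complexity parameter"] [cite: IPZ2001, §2  "complexity parameter"] -/
structure ParamProblem where
  /-- The underlying language over `Bool`. -/
  lang : Language Bool
  /-- The complexity parameter `p(x)` of an instance `x`. -/
  param : List Bool → ℕ

namespace ParamProblem

variable {α : Type}

open Classical in
/-- The parameterised problem of a math-level set `S ⊆ α` with parameter `p : α → ℕ` under a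
Boolean encoding `e`: the language is `e.toLanguage S = e.encode '' S`, and the parameter of a
string `x` is `p a` when `x` is the codeword `e.encode a` (detected as `e.decode x = some a`
and `e.encode a = x`), and the junk value `0` on non-codewords (documented in the module
docstring: non-codewords are outside the language and get the strictest time bound).
Noncomputable (the codeword test uses classical decidability of `e.encode a = x`).
[IPZ 2001, §2] [cite: IPZ2001, §2] -/
noncomputable def ofEncoding (e : Encoding α Bool) (S : Set α) (p : α → ℕ) : ParamProblem where
  lang := e.toLanguage S
  param x :=
    match e.decode x with
    | some a => if e.encode a = x then p a else 0
    | none => 0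

/-- The language of `ofEncoding e S p` is `e.toLanguage S` (definitional). [folklore] -/
@[simp] theorem ofEncoding_lang (e : Encoding α Bool) (S : Set α) (p : α → ℕ) :
    (ofEncoding e S p).lang = e.toLanguage S :=
  rfl

/-- On codewords the parameter of `ofEncoding e S p` is `p`: `param (e.encode a) = p a`.
[IPZ 2001, §2] [cite: IPZ2001, §2] -/
@[simp] theorem ofEncoding_param_encode (e : Encoding α Bool) (S : Set α) (p : α → ℕ) (a : α) :
    (ofEncoding e S p).param (e.encode a) = p a := by
  simp [ofEncoding, e.decode_encode]

end ParamProblem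

/-- `IsSubexpTimeBound ε p T`: the per-input time bound `T` is at most
`c · 2^{ε · p(x)} · (|x| + 1)^c` for some constant `c`, i.e. `T(x) ≤ poly(|x|) · 2^{ε p(x)}`.
The single natural `c` doubles as leading coefficient and polynomial degree (`c = 0` forces
`T = 0`, harmless under the existential; closure/transitivity proofs may assume `c ≥ 1`).
The exponent is real (`Real.rpow`). [IPZ 2001, §2 (time `poly(|x|) 2^{ε p(x)}`)] [cite: IPZ2001, §2 (time  poly(|x|] -/
def IsSubexpTimeBound (ε : ℝ) (p : List Bool → ℕ) (T : List Bool → ℕ) : Prop :=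
  ∃ c : ℕ, ∀ x : List Bool,
    (T x : ℝ) ≤ c * (2 : ℝ) ^ (ε * p x) * ((x.length : ℝ) + 1) ^ c

/-- The class `SE` of *subexponentially solvable* parameterised problems: `Q ∈ SE` iff for
every `ε > 0` some TM2 machine decides `Q.lang` (identity input encoding) within a time bound
`T` with `T(x) ≤ poly(|x|) · 2^{ε · Q.param x}`. Noncomputable (`DecidesInTime`).
[IPZ 2001, §2, Definition of SE] [cite: IPZ2001, §2  Definition of SE] -/
noncomputable def SE : Set ParamProblem :=
  {Q | ∀ ε : ℝ, 0 < ε → ∃ (T : List Bool → ℕ) (M : TM2ComputableAux Bool Bool),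
    IsSubexpTimeBound ε Q.param T ∧ DecidesInTime id Q.lang T M}

/-! ### SERF reductions -/

/-- `SERFReducible Q₁ Q₂`: `Q₁` reduces to `Q₂` by a *SubExponential Reduction Family*
(IPZ). For every `ε > 0` there is an oracle algorithm `M` (an interactive transcript,
`Literature.Computability.Complexity.OracleAlg`) with a round budget `fuel`, a per-input step-time bound `Tstep` and
a constant `C` such that

* `fuel x ≤ poly(|x|) · 2^{ε p₁(x)}` (`IsSubexpTimeBound`);
* the step function `(x, answers) ↦ M.step x answers` is computed by some TM2 machine within
  `Tstep (x, answers)` steps, on the input `boolPair x (listBool-encode answers)` and with the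
  tagged output encoding `sumBool` (exactly as in `OracleAlg.IsPolyTime`);
* `Tstep (x, answers) ≤ c · 2^{ε p₁(x)} · (|x| + 1)^c · (ℓ + 1)` for some `c`, where `ℓ` is
  the length of the `listBool`-encoded answer transcript (the machine's actual second input;
  the degree in `ℓ` is `1`, independent of `ε` — see the module docstring for why);
* with oracle `Q₂.lang` and `fuel x` rounds, `M` outputs the bit `[x ∈ Q₁.lang]`;
* every query `q` asked satisfies `p₂(q) ≤ C · p₁(x)` and `|q| ≤ C · (|x| + 1)^C`.

Caveats (module docstring, outline R2): the transcript model costs `2^{3ε p₁}·poly` in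
total, harmless under `∀ ε > 0`; IPZ also allow *randomised* (bounded-error Turing) SERF
reductions — v0 is deterministic only. Noncomputable (`Set.boolIndicator`,
`Oracle.ofLanguage`). [IPZ 2001, §2.1, Definition of SERF] [cite: IPZ2001, §2.1  Definition of SERF] -/
noncomputable def SERFReducible (Q₁ Q₂ : ParamProblem) : Prop :=
  ∀ ε : ℝ, 0 < ε → ∃ (M : OracleAlg Bool) (fuel : List Bool → ℕ)
    (Tstep : List Bool × List (List Bool) → ℕ) (C : ℕ),
    IsSubexpTimeBound ε Q₁.param fuel ∧
    (∃ N : TM2ComputableAux Bool Bool,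
      ComputesInTime
        (fun p : List Bool × List (List Bool) =>
          boolPair p.1 ((encodingList Bool).listBool.encode p.2))
        ((encodingList Bool).sumBool encodingBoolBool).encode
        (Function.uncurry M.step) Tstep N) ∧
    (∃ c : ℕ, ∀ (x : List Bool) (as : List (List Bool)),
      (Tstep (x, as) : ℝ) ≤ c * (2 : ℝ) ^ (ε * Q₁.param x) * ((x.length : ℝ) + 1) ^ c *
        ((((encodingList Bool).listBool.encode as).length : ℝ) + 1)) ∧
    (∀ x : List Bool, M.run (Oracle.ofLanguage Q₂.lang) (fuel x) x =
      some (Q₁.lang.boolIndicator x)) ∧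
    (∀ x : List Bool, ∀ q ∈ M.queries (Oracle.ofLanguage Q₂.lang) (fuel x) x,
      Q₂.param q ≤ C * Q₁.param x ∧ q.length ≤ C * (x.length + 1) ^ C)

/-! ### API -/

/-- Unfolding lemma for `SE`. [IPZ 2001, §2] [cite: IPZ2001, §2] -/
theorem mem_SE_iff {Q : ParamProblem} :
    Q ∈ SE ↔ ∀ ε : ℝ, 0 < ε → ∃ (T : List Bool → ℕ) (M : TM2ComputableAux Bool Bool),
      IsSubexpTimeBound ε Q.param T ∧ DecidesInTime id Q.lang T M :=
  Iff.rfl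

/-- A subexponential time bound is monotone in `ε` (for fixed parameter and bound).
[IPZ 2001, §2] [cite: IPZ2001, §2] -/
theorem IsSubexpTimeBound.mono {ε ε' : ℝ} {p : List Bool → ℕ} {T : List Bool → ℕ}
    (h : IsSubexpTimeBound ε p T) (hε : ε ≤ ε') : IsSubexpTimeBound ε' p T := by
  obtain ⟨c, hc⟩ := h
  refine ⟨c, fun x => (hc x).trans ?_⟩
  gcongr
  exact one_le_two

/-- A subexponential time bound for parameter `p` is one for any pointwise larger parameter
`p'` (when `0 ≤ ε`). [IPZ 2001, §2] [cite: IPZ2001, §2] -/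
theorem IsSubexpTimeBound.of_param_le {ε : ℝ} (hε : 0 ≤ ε) {p p' : List Bool → ℕ}
    {T : List Bool → ℕ} (h : IsSubexpTimeBound ε p T) (hp : ∀ x, p x ≤ p' x) :
    IsSubexpTimeBound ε p' T := by
  obtain ⟨c, hc⟩ := h
  refine ⟨c, fun x => (hc x).trans ?_⟩
  gcongr
  · exact one_le_two
  · exact_mod_cast hp x

/-- `SE` is monotone in the parameter (outline names: `SE_param_mono`, `SE.of_param_le`): if
`Q ∈ SE` and `Q'` has the same language and a pointwise larger parameter, then `Q' ∈ SE`
(a bound `2^{ε p}` is also a bound `2^{ε p'}`). [IPZ 2001, §2] [cite: IPZ2001, §2] -/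
theorem mem_SE_of_param_le {Q Q' : ParamProblem} (hQ : Q ∈ SE) (hl : Q'.lang = Q.lang)
    (hp : ∀ x, Q.param x ≤ Q'.param x) : Q' ∈ SE := by
  intro ε hε
  obtain ⟨T, M, hT, hM⟩ := hQ ε hε
  exact ⟨T, M, hT.of_param_le hε.le hp, hl ▸ hM⟩

/-- Membership in `SE` only has to be checked along the sequence `ε = 1/(k+1)`:
`Q ∈ SE ↔ ∀ k : ℕ, Q` is decidable in time `poly(|x|) · 2^{p(x)/(k+1)}` (monotonicity in `ε`
and the Archimedean property). [IPZ 2001, §2 ("for every fixed k, time 2^{p/k}")] [cite: IPZ2001, §2 ("for every fixed k  time 2^{p/k}"] -/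
theorem mem_SE_iff_forall_delta {Q : ParamProblem} :
    Q ∈ SE ↔ ∀ k : ℕ, ∃ (T : List Bool → ℕ) (M : TM2ComputableAux Bool Bool),
      IsSubexpTimeBound (1 / ((k : ℝ) + 1)) Q.param T ∧ DecidesInTime id Q.lang T M := by
  refine ⟨fun h k => h _ (by positivity), fun h ε hε => ?_⟩
  obtain ⟨k, hk⟩ := exists_nat_one_div_lt hε
  obtain ⟨T, M, hT, hM⟩ := h k
  exact ⟨T, M, hT.mono hk.le, hM⟩

/-- SERF reducibility is reflexive: query the input itself (one round, `p₂(q) = p₁(x)`,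
`|q| = |x|`). [IPZ 2001, §2.1] [cite: IPZ2001, §2.1] -/
def SERFReducible.refl : Prop :=
  ∀ (Q : ParamProblem),
    SERFReducible Q Q

/-- SERF reducibility is transitive: answer each query of the first family (with parameter
`ε/(2C)`, say) by running the second family; parameters of queries stay `O(p₁(x))` and the
exponents add up to at most `ε p₁(x)`. [IPZ 2001, §2.1 (SERF reductions compose)] [cite: IPZ2001, §2.1 (SERF reductions compose] -/
def SERFReducible.trans : Prop :=
  ∀ {Q₁ Q₂ Q₃ : ParamProblem} (h₁₂ : SERFReducible Q₁ Q₂) (h₂₃ : SERFReducible Q₂ Q₃),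
    SERFReducible Q₁ Q₃

/-- `SE` is closed downwards under SERF reductions: if `Q₁` SERF-reduces to `Q₂` and
`Q₂ ∈ SE` then `Q₁ ∈ SE` (given `ε`, run the `ε/4`-reduction — total transcript cost
`2^{3ε p₁/4}·poly` — and answer its queries `q`, which have `p₂(q) ≤ C p₁(x)` and polynomial
length, with an `ε/(4C)`-algorithm for `Q₂`). Relies on the ε-independent (linear) degree of
the step bound in the transcript length.
[IPZ 2001, §2.1, Lemma (SE is closed under SERF reducibility)] [cite: IPZ2001, §2.1  Lemma (SE is closed under SERF red] -/
def mem_SE_of_serfReducible : Prop :=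
  ∀ {Q₁ Q₂ : ParamProblem} (h : SERFReducible Q₁ Q₂) (h₂ : Q₂ ∈ SE),
    Q₁ ∈ SE

end Literature.Computability.Cryptography
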